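import Literature.MathematicalPhysics.QuantumFieldTheory.Balaban1983to89.B9CoReadingCoordsS

/-!
# `Balaban1983to89.B9SiteKernelBlockMajorant` — [B9] (3.49) p. 399 READ AS [4]-(2.51) BLOCK MAJORANTS: from KERNEL bounds of a site-sector letter
# («|P(x, x′)| ≤ …(L^{j′}η)^{−d}… for x ∈ Δ(y), x′ ∈ Δ(y′)», all block pairs) to the block majorant of its κ-fold COORDINATE MODEL on n06-d's site carrier

T. Bałaban, *Propagators for lattice gauge theories in a background field*, Commun. Math. Phys. **99** (1985) 389–434 [`Balaban1985BackgroundPropagators`,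
"B9"]; [4] = T. Bałaban, *Propagators and renormalization transformations for lattice gauge theories. II*, Commun. Math. Phys. **96** (1984) 223–250
[`Balaban1984PropagatorsII`].  statement-level skeleton of published theorems with citation tags; proofs where landed; nothing here is a claim about
the Yang–Mills mass gap.

THE PRINT.  p. 399, (3.49): *«[|P(x, x′)|, |(DP)_μ(x, x′)|, |(PD\*)_ν(x, x′)|, …] ≦ O(1)[1, (Lʲη)⁻¹, (Lʲη)⁻¹, …](L^{j′}η)^{−d}e^{−½δ₀d(y,y′)} for x ∈ Δ(y),
x′ ∈ Δ(y′)»*; [4] p. 232, (2.51): *«|(G_k(Γ_j)λ)(x)| ≦ … |λ| for supp λ ⊂ B^j(y′)»*; p. 421: *«… using Theorem 3.1 and the inequality (3.49)»*.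

THE POINT (dag-n06-d ASK-3 Q2; rows 20–21's use of row 25).  Row 25 of the N06 certificate holds (3.49) as KERNEL bounds (`B9Ineq349SiteReading.fineEntryS`,
n06-i), whereas rows 20–21 need the (3.49) letter as [4]-(2.51) BLOCK MAJORANTS of its coordinate model (`B9PerturbationMajorantAlgebra.Proj349Maj` of
`PcoK = coordOpK b (P349Y …)`).  The passage is print's silent «summed over an input block Δ(y′): η^{d′}·#Δ(y′)·(L^{j′}η)^{−d′} = 1»; this file is its GENERIC
half (one operator, one configuration; the member-uniform counting is the sequel):
* §1 ★★ `hasMajorant_coordOpK_of_kernel` — for ANY ℝ-linear family `T ν` on `S → 𝔸` with a fibre kernel bound `‖T ν (δ_w ⊗ a)(z)‖ ≤ K₀(z, w)·‖a‖` and ANY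
  site block map `σ`, `coordOpK b T` has the block majorant `K` w.r.t. `p ↦ σ p.1` once `coordBound·basisBound·Σ_{w : σ w = y′} K₀(z, w) ≤ K(σ z, y′)`;
* §2 the (3.49) entries as fibre kernel bounds: `norm_apply_deltaY_le_fineEntryS₀` ∕ `norm_cdS_apply_deltaY_le_fineEntryS₁` ∕ `norm_apply_cdsS_deltaY_le_fineEntryS₂`
  (the `sup` of `fineEntryS` is bounded in finite dimension, `exists_bound_apply_deltaY`);
* §3 `DcoS_comp_coordOpK`, `coordOpK_comp_DscoS`, ★★ `hasMajorant_model₀ ∕ ₁ ∕ ₂` — block majorants of `coordOpK b (O U)`, `DcoS ∘ coordOpK b (O U)`,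
  `coordOpK b (O U) ∘ DscoS` on `p ↦ σ p.1` from ALL-BLOCKS bounds of `fineEntryS … 0 ∕ 1 ∕ 2` and a counting hypothesis.
HONEST SCOPE.  Finite sums and finite-dimensional linear algebra; (3.49) stays row 25's content; nothing of [B9]∕[4] asserted; count-neutral; N06 NOT
discharged; nothing continuum ∕ ℝ⁴ ∕ OS ∕ mass gap ∕ Clay.  Cell `pub-ymgap` (D-0062), node N06 [B9], rows 20–21, seat `pub-ymgap-dag-n06-l` (g15), 2026-08-28.
-/

noncomputable section

namespace Literature.MathematicalPhysics.QuantumFieldTheory.Balaban1983to89.B9SiteKernelBlockMajorant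

open B6RandomWalk (HasMajorant BlockSupp)
open B6RandomWalkHom (HasMajorantHom)
open B6Geom246MultiLevelBox (blkOf)
open B6KLevelCensusIndexV1 (KIdx)
open B9Thm39ReadingCoords (coordBound39 basisBound39 abs_repr_le)
open B9CoReadingCoords (assembleK coordOpK coordOpK_apply coordOpK_comp)
open B9CoReadingCoordsS (XSK blkSK DcoS DscoS)
open B9Ineq349SiteReading (fineEntryS dpow349 supBlkS_nonneg)
open B9Ineq349SiteComposite (cdSL cdsSL cdSL_apply cdsSL_apply etaS_pos sum_deltaY' deltaY_smul')
open Node00 (SiteY BlkY CfgY SiteOpY BallY etaS deltaY cdS cdsS supBlkS supBlkS')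

variable {𝔸 : Type} [NormedRing 𝔸] [NormedAlgebra ℂ 𝔸] [FiniteDimensional ℝ 𝔸]
variable {κ : Type} [Fintype κ]

/-! ## §1 The coordinate model of a family with a fibre kernel bound has a block majorant -/

section Core

variable {S D : Type} [Fintype S] (b : Module.Basis κ ℝ 𝔸) {g : B6.Geometry}

omit [FiniteDimensional ℝ 𝔸] [Fintype S] in
/-- the assembled fibre vector `Σ_a f(w, ν, a, c′)·b_a` is `≤ (Σ_a ‖b_a‖)·M` when its coordinates are `≤ M`. [cite: Balaban1984PropagatorsII, (2.51) p.232 («|λ|»), dictionary] -/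
theorem norm_assembleK_le (ν : D) (c' : κ) (f : S × D × κ × κ → ℝ) (w : S) {M : ℝ} (hM : ∀ a, |f (w, ν, a, c')| ≤ M) :
    ‖assembleK b ν c' f w‖ ≤ basisBound39 b * M := by
  show ‖∑ a, f (w, ν, a, c') • b a‖ ≤ _
  calc ‖∑ a, f (w, ν, a, c') • b a‖ ≤ ∑ a, ‖f (w, ν, a, c') • b a‖ := norm_sum_le _ _
    _ = ∑ a, |f (w, ν, a, c')| * ‖b a‖ := by simp [norm_smul]
    _ ≤ ∑ a, M * ‖b a‖ := Finset.sum_le_sum fun a _ => mul_le_mul_of_nonneg_right (hM a) (norm_nonneg _)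
    _ = basisBound39 b * M := by rw [← Finset.mul_sum, basisBound39, mul_comm]

omit [FiniteDimensional ℝ 𝔸] [Fintype S] in
/-- the assembled fibre vector vanishes where all coordinates vanish. [cite: Balaban1984PropagatorsII, (2.51) p.232 («supp λ ⊂ B^j(y′)»), dictionary] -/
theorem assembleK_eq_zero_of (ν : D) (c' : κ) (f : S × D × κ × κ → ℝ) (w : S) (h : ∀ a, f (w, ν, a, c') = 0) :
    assembleK b ν c' f w = 0 := by
  show ∑ a, f (w, ν, a, c') • b a = 0
  exact Finset.sum_eq_zero fun a _ => by rw [h a, zero_smul]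

/-- ★★ **THE COORDINATE MODEL OF A FAMILY WITH A FIBRE KERNEL BOUND HAS A BLOCK MAJORANT** ([4] (2.51) from kernel entries, summed over the input block):
for ℝ-linear `T ν` on `S → 𝔸` with `‖T ν (δ_w ⊗ a)(z)‖ ≤ K₀(z, w)·‖a‖` (`K₀ ≥ 0`) and a site block map `σ`, the model `coordOpK b T` on `S × D × κ × κ` has
the block majorant `K` w.r.t. `p ↦ σ p.1` whenever `coordBound(b)·basisBound(b)·Σ_{w : σ w = y′} K₀(z, w) ≤ K(σ z, y′)` for all `z, y′`.
[cite: Balaban1984PropagatorsII, (2.51) p.232; Balaban1985BackgroundPropagators, (3.49) p.399 («x ∈ Δ(y), x′ ∈ Δ(y′)»)] -/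
theorem hasMajorant_coordOpK_of_kernel [DecidableEq g.Site] (σ : S → g.Site) (T : D → (S → 𝔸) →ₗ[ℝ] (S → 𝔸)) (K₀ : S → S → ℝ)
    (hK₀ : ∀ (ν : D) (z w : S) (a : 𝔸), ‖T ν (deltaY w a) z‖ ≤ K₀ z w * ‖a‖) (hK₀nn : ∀ z w, 0 ≤ K₀ z w)
    {K : g.Site → g.Site → ℝ}
    (hK : ∀ (z : S) (y' : g.Site), coordBound39 b * basisBound39 b * (∑ w ∈ Finset.univ.filter (fun w => σ w = y'), K₀ z w) ≤ K (σ z) y') :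
    HasMajorant (g := g) (fun p : S × D × κ × κ => σ p.1) (coordOpK b T) K := by
  classical
  intro y' f Bd hf v
  obtain ⟨z, ν, c, c'⟩ := v
  rw [coordOpK_apply]
  set h : S → 𝔸 := assembleK b ν c' f with hh
  have hoff : ∀ w, σ w ≠ y' → h w = 0 := fun w hw => assembleK_eq_zero_of b ν c' f w fun a => hf.off (w, ν, a, c') hw
  have hbd : ∀ w, σ w = y' → ‖h w‖ ≤ basisBound39 b * Bd := fun w hw =>
    norm_assembleK_le b ν c' f w fun a => hf.bound (w, ν, a, c') hw
  have hT : ‖T ν h z‖ ≤ ∑ w, K₀ z w * ‖h w‖ := by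
    conv_lhs => rw [← sum_deltaY' h]
    rw [map_sum, Finset.sum_apply]
    exact (norm_sum_le _ _).trans (Finset.sum_le_sum fun w _ => hK₀ ν z w (h w))
  have hsum : ∑ w, K₀ z w * ‖h w‖ ≤ (∑ w ∈ Finset.univ.filter (fun w => σ w = y'), K₀ z w) * (basisBound39 b * Bd) := by
    rw [Finset.sum_mul, ← Finset.sum_filter_add_sum_filter_not Finset.univ (fun w => σ w = y')]
    have h0 : ∑ w ∈ Finset.univ.filter (fun w => ¬σ w = y'), K₀ z w * ‖h w‖ = 0 :=
      Finset.sum_eq_zero fun w hw => by rw [hoff w (Finset.mem_filter.1 hw).2, norm_zero, mul_zero]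
    rw [h0, add_zero]
    exact Finset.sum_le_sum fun w hw => mul_le_mul_of_nonneg_left (hbd w (Finset.mem_filter.1 hw).2) (hK₀nn z w)
  have hcb : 0 ≤ coordBound39 b := norm_nonneg _
  calc |b.repr (T ν h z) c| ≤ coordBound39 b * ‖T ν h z‖ := abs_repr_le b _ c
    _ ≤ coordBound39 b * ((∑ w ∈ Finset.univ.filter (fun w => σ w = y'), K₀ z w) * (basisBound39 b * Bd)) :=
        mul_le_mul_of_nonneg_left (hT.trans hsum) hcb
    _ = coordBound39 b * basisBound39 b * (∑ w ∈ Finset.univ.filter (fun w => σ w = y'), K₀ z w) * Bd := by ring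
    _ ≤ K (σ z) y' * Bd := mul_le_mul_of_nonneg_right (hK z y') hf.nonneg

end Core

/-! ## §2 The (3.49) entries of a site-sector letter as fibre kernel bounds -/

section Entries

variable [CompleteSpace 𝔸]
variable {d ℓ : ℕ} {hd : 1 ≤ d + 1} {hL : Odd (ℓ + 1) ∧ 1 < ℓ + 1} {b₀ b₁ : ℝ} (i : KIdx d ℓ hd hL b₀ b₁)

omit [NormedAlgebra ℂ 𝔸] [FiniteDimensional ℝ 𝔸] [CompleteSpace 𝔸] in
/-- `‖Ψ(z)‖ ≤ sup_{Δ(z)} ‖Ψ‖`. [cite: Balaban1985BackgroundPropagators, (3.42) p.397 («x ∈ Δ(y)»), bookkeeping] -/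
theorem norm_le_supBlkS_self (Ψ : SiteY i → 𝔸) (z : SiteY i) : ‖Ψ z‖ ≤ supBlkS i (blkOf i.D.toDomains z) Ψ := by
  classical
  unfold supBlkS
  refine le_trans ?_ (le_ciSup (f := fun w : SiteY i => if blkOf i.D.toDomains w = blkOf i.D.toDomains z then ‖Ψ w‖ else 0)
    (Set.finite_range _).bddAbove z)
  rw [if_pos rfl]

omit [NormedAlgebra ℂ 𝔸] [FiniteDimensional ℝ 𝔸] [CompleteSpace 𝔸] in
/-- `‖Ψ_μ(z)‖ ≤ sup_{Δ(z), μ} ‖Ψ‖`. [cite: Balaban1985BackgroundPropagators, (3.42) p.397 («x ∈ Δ(y)»), bookkeeping] -/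
theorem norm_le_supBlkS'_self (Ψ : Fin (d + 1) → SiteY i → 𝔸) (z : SiteY i) (μ : Fin (d + 1)) :
    ‖Ψ μ z‖ ≤ supBlkS' i (blkOf i.D.toDomains z) Ψ := by
  classical
  unfold supBlkS'
  refine le_trans ?_ (le_ciSup (f := fun p : SiteY i × Fin (d + 1) =>
    if blkOf i.D.toDomains p.1 = blkOf i.D.toDomains z then ‖Ψ p.2 p.1‖ else 0) (Set.finite_range _).bddAbove (z, μ))
  rw [if_pos rfl]

omit [NormedAlgebra ℂ 𝔸] [FiniteDimensional ℝ 𝔸] [CompleteSpace 𝔸] in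
/-- a block sup is at most the sup norm. [cite: Balaban1985BackgroundPropagators, (3.42) p.397, bookkeeping] -/
theorem supBlkS_le_norm (s : BlkY i) (Ψ : SiteY i → 𝔸) : supBlkS i s Ψ ≤ ‖Ψ‖ := by
  classical
  unfold supBlkS
  refine Real.iSup_le (fun z => ?_) (norm_nonneg _)
  split_ifs
  · exact norm_le_pi_norm Ψ z
  · exact norm_nonneg _

omit [NormedAlgebra ℂ 𝔸] [FiniteDimensional ℝ 𝔸] [CompleteSpace 𝔸] in
/-- a directional block sup is at most any common bound of the sup norms. [cite: Balaban1985BackgroundPropagators, (3.42) p.397, bookkeeping] -/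
theorem supBlkS'_le_of_norm_le (s : BlkY i) (Ψ : Fin (d + 1) → SiteY i → 𝔸) {C : ℝ} (hC : 0 ≤ C) (h : ∀ μ, ‖Ψ μ‖ ≤ C) :
    supBlkS' i s Ψ ≤ C := by
  classical
  unfold supBlkS'
  refine Real.iSup_le (fun p => ?_) hC
  split_ifs
  · exact (norm_le_pi_norm (Ψ p.2) p.1).trans (h p.2)
  · exact hC

omit [NormedAlgebra ℂ 𝔸] [FiniteDimensional ℝ 𝔸] [CompleteSpace 𝔸] in
/-- `‖δ_w ⊗ E‖_∞ ≤ ‖E‖`. [cite: Balaban1985BackgroundPropagators, (3.19) p.393, bookkeeping] -/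
theorem norm_deltaY_le (w : SiteY i) (E : 𝔸) : ‖deltaY w E‖ ≤ ‖E‖ := by
  classical
  refine (pi_norm_le_iff_of_nonneg (norm_nonneg E)).2 fun z => ?_
  unfold deltaY
  split_ifs
  · exact le_rfl
  · rw [norm_zero]; exact norm_nonneg _

/-- a ℂ-linear site operator is uniformly bounded on the test functions `δ_w ⊗ E`, `‖E‖ ≤ 1` (finite dimension). [cite: Balaban1985BackgroundPropagators, (3.49) p.399, bookkeeping] -/
theorem exists_bound_apply_deltaY (A : (SiteY i → 𝔸) →ₗ[ℂ] (SiteY i → 𝔸)) :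
    ∃ C : ℝ, 0 ≤ C ∧ ∀ (w : SiteY i) (E : BallY 𝔸), ‖A (deltaY w (E : 𝔸))‖ ≤ C := by
  set Ac := LinearMap.toContinuousLinearMap (A.restrictScalars ℝ) with hAc
  refine ⟨‖Ac‖, norm_nonneg Ac, fun w E => ?_⟩
  have hE : ‖(E : 𝔸)‖ ≤ 1 := mem_closedBall_zero_iff.1 E.2
  have h1 : ‖Ac (deltaY w (E : 𝔸))‖ ≤ ‖Ac‖ * ‖deltaY w (E : 𝔸)‖ := Ac.le_opNorm _
  exact h1.trans (mul_le_of_le_one_right (norm_nonneg Ac) ((norm_deltaY_le i w _).trans hE))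

omit [FiniteDimensional ℝ 𝔸] in
/-- real scaling out of the test direction: `a = ‖a‖·E` with `‖E‖ ≤ 1`, and `O(δ_w ⊗ a) = ‖a‖·O(δ_w ⊗ E)` for ℂ-linear `O`.
[cite: Balaban1985BackgroundPropagators, (3.49) p.399 (the kernel as a fibre operator), bookkeeping] -/
theorem exists_unit_smul (a : 𝔸) : ∃ E : BallY 𝔸, a = ((‖a‖ : ℝ) : ℂ) • (E : 𝔸) := by
  by_cases ha : a = 0
  · refine ⟨⟨0, Metric.mem_closedBall_self zero_le_one⟩, ?_⟩
    rw [ha, norm_zero]; simp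
  · have hr : 0 < ‖a‖ := norm_pos_iff.2 ha
    refine ⟨⟨((‖a‖⁻¹ : ℝ) : ℂ) • a, ?_⟩, ?_⟩
    · rw [mem_closedBall_zero_iff, norm_smul, Complex.norm_real, Real.norm_eq_abs, abs_of_pos (inv_pos.2 hr),
        inv_mul_cancel₀ hr.ne']
    · show a = ((‖a‖ : ℝ) : ℂ) • (((‖a‖⁻¹ : ℝ) : ℂ) • a)
      rw [smul_smul, ← Complex.ofReal_mul, mul_inv_cancel₀ hr.ne', Complex.ofReal_one, one_smul]

open Classical in
/-- ★ **THE FIRST (3.49) ENTRY AS A FIBRE KERNEL BOUND**: `‖(O_U(δ_w ⊗ a))(z)‖ ≤ η^{d′}·P₀(Δ(z), Δ(w))·‖a‖` with `P₀ = fineEntryS … 0`.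
[cite: Balaban1985BackgroundPropagators, (3.49) p.399 («|P(x, x′)|»)] -/
theorem norm_apply_deltaY_le_fineEntryS₀ (O : SiteOpY 𝔸 i) (U : CfgY 𝔸 i) (z w : SiteY i) (a : 𝔸) :
    ‖O U (deltaY w a) z‖ ≤ etaS i ^ (d + 1) * fineEntryS i O U (blkOf i.D.toDomains z) (blkOf i.D.toDomains w) 0 * ‖a‖ := by
  set s := blkOf i.D.toDomains z with hs
  set s' := blkOf i.D.toDomains w with hs'
  set W : BallY 𝔸 → {x : SiteY i // blkOf i.D.toDomains x = s'} → ℝ := fun E x' =>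
      ((![supBlkS i s (O U (deltaY x'.1 (E : 𝔸))),
          supBlkS' i s (fun μ => cdS i U μ (O U (deltaY x'.1 (E : 𝔸)))),
          ⨆ ν : Fin (d + 1), supBlkS i s (O U (cdsS i U ν (deltaY x'.1 (E : 𝔸)))),
          ⨆ ν : Fin (d + 1), supBlkS' i s (fun μ => cdS i U μ (O U (cdsS i U ν (deltaY x'.1 (E : 𝔸)))))] : Fin 4 → ℝ) 0) with hW
  set V : BallY 𝔸 → ℝ := fun E => ⨆ x', W E x' with hV
  have hfe : etaS i ^ (d + 1) * fineEntryS i O U s s' 0 = ⨆ E : BallY 𝔸, V E := by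
    show etaS i ^ (d + 1) * ((etaS i)⁻¹ ^ (d + 1 + 0) * ⨆ E : BallY 𝔸, V E) = _
    rw [add_zero, ← mul_assoc, ← mul_pow, mul_inv_cancel₀ (etaS_pos i).ne', one_pow, one_mul]
  obtain ⟨C, hC0, hC⟩ := exists_bound_apply_deltaY i (O U)
  have hVle : ∀ E, V E ≤ C := fun E => by
    refine Real.iSup_le (fun x' => ?_) hC0
    show supBlkS i s (O U (deltaY x'.1 (E : 𝔸))) ≤ C
    exact (supBlkS_le_norm i s _).trans (hC x'.1 E)
  have hbdd : BddAbove (Set.range V) := ⟨C, by rintro _ ⟨E, rfl⟩; exact hVle E⟩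
  have hpt : ∀ E : BallY 𝔸, ‖O U (deltaY w (E : 𝔸)) z‖ ≤ ⨆ E, V E := fun E => by
    refine le_trans ?_ (le_ciSup hbdd E)
    refine le_trans ?_ (le_ciSup (f := W E) (Set.finite_range _).bddAbove ⟨w, rfl⟩)
    exact norm_le_supBlkS_self i (O U (deltaY w (E : 𝔸))) z
  obtain ⟨E₀, ha⟩ := exists_unit_smul a
  have h1 : O U (deltaY w a) = ((‖a‖ : ℝ) : ℂ) • O U (deltaY w (E₀ : 𝔸)) := by
    conv_lhs => rw [ha]
    rw [deltaY_smul', map_smul]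
  rw [h1, Pi.smul_apply, norm_smul, Complex.norm_real, Real.norm_eq_abs, abs_norm, hfe, mul_comm]
  exact mul_le_mul_of_nonneg_right (hpt E₀) (norm_nonneg a)

/-- a finite family of ℂ-linear site operators is uniformly bounded on the test functions `δ_w ⊗ E`, `‖E‖ ≤ 1`. [cite: Balaban1985BackgroundPropagators, (3.49) p.399, bookkeeping] -/
theorem exists_bound_apply_deltaY_family {I : Type} [Fintype I] (A : I → (SiteY i → 𝔸) →ₗ[ℂ] (SiteY i → 𝔸)) :
    ∃ C : ℝ, 0 ≤ C ∧ ∀ (μ : I) (w : SiteY i) (E : BallY 𝔸), ‖A μ (deltaY w (E : 𝔸))‖ ≤ C := by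
  classical
  have h := fun μ => exists_bound_apply_deltaY i (A μ)
  choose C hC0 hC using h
  refine ⟨∑ μ, C μ, Finset.sum_nonneg fun μ _ => hC0 μ, fun μ w E => (hC μ w E).trans ?_⟩
  exact Finset.single_le_sum (f := C) (fun μ _ => hC0 μ) (Finset.mem_univ μ)

open Classical in
/-- ★ **THE SECOND (3.49) ENTRY AS A FIBRE KERNEL BOUND**: `‖(∇_{U,μ}O_U(δ_w ⊗ a))(z)‖ ≤ η^{d′+1}·P₁(Δ(z), Δ(w))·‖a‖` with `P₁ = fineEntryS … 1`.
[cite: Balaban1985BackgroundPropagators, (3.49) p.399 («|(DP)_μ(x, x′)|»), (3.3) p.390] -/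
theorem norm_cdS_apply_deltaY_le_fineEntryS₁ (O : SiteOpY 𝔸 i) (U : CfgY 𝔸 i) (μ : Fin (d + 1)) (z w : SiteY i) (a : 𝔸) :
    ‖cdS i U μ (O U (deltaY w a)) z‖ ≤
      etaS i ^ (d + 1 + 1) * fineEntryS i O U (blkOf i.D.toDomains z) (blkOf i.D.toDomains w) 1 * ‖a‖ := by
  set s := blkOf i.D.toDomains z with hs
  set s' := blkOf i.D.toDomains w with hs'
  set W : BallY 𝔸 → {x : SiteY i // blkOf i.D.toDomains x = s'} → ℝ := fun E x' =>
      ((![supBlkS i s (O U (deltaY x'.1 (E : 𝔸))),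
          supBlkS' i s (fun μ => cdS i U μ (O U (deltaY x'.1 (E : 𝔸)))),
          ⨆ ν : Fin (d + 1), supBlkS i s (O U (cdsS i U ν (deltaY x'.1 (E : 𝔸)))),
          ⨆ ν : Fin (d + 1), supBlkS' i s (fun μ => cdS i U μ (O U (cdsS i U ν (deltaY x'.1 (E : 𝔸)))))] : Fin 4 → ℝ) 1) with hW
  set V : BallY 𝔸 → ℝ := fun E => ⨆ x', W E x' with hV
  have hfe : etaS i ^ (d + 1 + 1) * fineEntryS i O U s s' 1 = ⨆ E : BallY 𝔸, V E := by
    show etaS i ^ (d + 1 + 1) * ((etaS i)⁻¹ ^ (d + 1 + 1) * ⨆ E : BallY 𝔸, V E) = _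
    rw [← mul_assoc, ← mul_pow, mul_inv_cancel₀ (etaS_pos i).ne', one_pow, one_mul]
  obtain ⟨C, hC0, hC⟩ := exists_bound_apply_deltaY_family i (fun μ : Fin (d + 1) => cdSL i U μ ∘ₗ O U)
  have hVle : ∀ E, V E ≤ C := fun E => by
    refine Real.iSup_le (fun x' => ?_) hC0
    show supBlkS' i s (fun μ => cdS i U μ (O U (deltaY x'.1 (E : 𝔸)))) ≤ C
    exact supBlkS'_le_of_norm_le i s _ hC0 fun μ' => hC μ' x'.1 E
  have hbdd : BddAbove (Set.range V) := ⟨C, by rintro _ ⟨E, rfl⟩; exact hVle E⟩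
  have hpt : ∀ E : BallY 𝔸, ‖cdS i U μ (O U (deltaY w (E : 𝔸))) z‖ ≤ ⨆ E, V E := fun E => by
    refine le_trans ?_ (le_ciSup hbdd E)
    refine le_trans ?_ (le_ciSup (f := W E) (Set.finite_range _).bddAbove ⟨w, rfl⟩)
    exact norm_le_supBlkS'_self i (fun μ => cdS i U μ (O U (deltaY w (E : 𝔸)))) z μ
  obtain ⟨E₀, ha⟩ := exists_unit_smul a
  have h1 : cdS i U μ (O U (deltaY w a)) = ((‖a‖ : ℝ) : ℂ) • cdS i U μ (O U (deltaY w (E₀ : 𝔸))) := by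
    conv_lhs => rw [ha]
    rw [deltaY_smul', map_smul, ← cdSL_apply, map_smul, cdSL_apply]
  rw [h1, Pi.smul_apply, norm_smul, Complex.norm_real, Real.norm_eq_abs, abs_norm, hfe, mul_comm]
  exact mul_le_mul_of_nonneg_right (hpt E₀) (norm_nonneg a)

open Classical in
/-- ★ **THE THIRD (3.49) ENTRY AS A FIBRE KERNEL BOUND**: `‖(O_U∇*_{U,ν}(δ_w ⊗ a))(z)‖ ≤ η^{d′+1}·P₂(Δ(z), Δ(w))·‖a‖` with `P₂ = fineEntryS … 2`.
[cite: Balaban1985BackgroundPropagators, (3.49) p.399 («|(PD*)_ν(x, x′)|»), (3.8) p.392] -/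
theorem norm_apply_cdsS_deltaY_le_fineEntryS₂ (O : SiteOpY 𝔸 i) (U : CfgY 𝔸 i) (ν : Fin (d + 1)) (z w : SiteY i) (a : 𝔸) :
    ‖O U (cdsS i U ν (deltaY w a)) z‖ ≤
      etaS i ^ (d + 1 + 1) * fineEntryS i O U (blkOf i.D.toDomains z) (blkOf i.D.toDomains w) 2 * ‖a‖ := by
  set s := blkOf i.D.toDomains z with hs
  set s' := blkOf i.D.toDomains w with hs'
  set W : BallY 𝔸 → {x : SiteY i // blkOf i.D.toDomains x = s'} → ℝ := fun E x' =>
      ((![supBlkS i s (O U (deltaY x'.1 (E : 𝔸))),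
          supBlkS' i s (fun μ => cdS i U μ (O U (deltaY x'.1 (E : 𝔸)))),
          ⨆ ν : Fin (d + 1), supBlkS i s (O U (cdsS i U ν (deltaY x'.1 (E : 𝔸)))),
          ⨆ ν : Fin (d + 1), supBlkS' i s (fun μ => cdS i U μ (O U (cdsS i U ν (deltaY x'.1 (E : 𝔸)))))] : Fin 4 → ℝ) 2) with hW
  set V : BallY 𝔸 → ℝ := fun E => ⨆ x', W E x' with hV
  have hfe : etaS i ^ (d + 1 + 1) * fineEntryS i O U s s' 2 = ⨆ E : BallY 𝔸, V E := by
    show etaS i ^ (d + 1 + 1) * ((etaS i)⁻¹ ^ (d + 1 + 1) * ⨆ E : BallY 𝔸, V E) = _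
    rw [← mul_assoc, ← mul_pow, mul_inv_cancel₀ (etaS_pos i).ne', one_pow, one_mul]
  obtain ⟨C, hC0, hC⟩ := exists_bound_apply_deltaY_family i (fun ν : Fin (d + 1) => O U ∘ₗ cdsSL i U ν)
  have hVle : ∀ E, V E ≤ C := fun E => by
    refine Real.iSup_le (fun x' => ?_) hC0
    show (⨆ ν : Fin (d + 1), supBlkS i s (O U (cdsS i U ν (deltaY x'.1 (E : 𝔸))))) ≤ C
    exact Real.iSup_le (fun ν' => (supBlkS_le_norm i s _).trans (hC ν' x'.1 E)) hC0
  have hbdd : BddAbove (Set.range V) := ⟨C, by rintro _ ⟨E, rfl⟩; exact hVle E⟩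
  have hpt : ∀ E : BallY 𝔸, ‖O U (cdsS i U ν (deltaY w (E : 𝔸))) z‖ ≤ ⨆ E, V E := fun E => by
    refine le_trans ?_ (le_ciSup hbdd E)
    refine le_trans ?_ (le_ciSup (f := W E) (Set.finite_range _).bddAbove ⟨w, rfl⟩)
    show ‖O U (cdsS i U ν (deltaY w (E : 𝔸))) z‖ ≤ ⨆ ν' : Fin (d + 1), supBlkS i s (O U (cdsS i U ν' (deltaY w (E : 𝔸))))
    refine le_trans ?_ (le_ciSup (f := fun ν' : Fin (d + 1) => supBlkS i s (O U (cdsS i U ν' (deltaY w (E : 𝔸)))))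
      (Set.finite_range _).bddAbove ν)
    exact norm_le_supBlkS_self i (O U (cdsS i U ν (deltaY w (E : 𝔸)))) z
  obtain ⟨E₀, ha⟩ := exists_unit_smul a
  have h1 : O U (cdsS i U ν (deltaY w a)) = ((‖a‖ : ℝ) : ℂ) • O U (cdsS i U ν (deltaY w (E₀ : 𝔸))) := by
    conv_lhs => rw [ha]
    rw [deltaY_smul', ← cdsSL_apply, map_smul, map_smul, cdsSL_apply]
  rw [h1, Pi.smul_apply, norm_smul, Complex.norm_real, Real.norm_eq_abs, abs_norm, hfe, mul_comm]
  exact mul_le_mul_of_nonneg_right (hpt E₀) (norm_nonneg a)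

end Entries

/-! ## §3 The three site-carrier models of a letter and their block majorants from all-blocks (3.49) entries -/

section Models

variable [CompleteSpace 𝔸]
variable {d ℓ : ℕ} {hd : 1 ≤ d + 1} {hL : Odd (ℓ + 1) ∧ 1 < ℓ + 1} {b₀ b₁ : ℝ} (i : KIdx d ℓ hd hL b₀ b₁)
variable (b : Module.Basis κ ℝ 𝔸) (B : B9.Backgrounds) (cfg : B.Cfg → CfgY 𝔸 i) (O : SiteOpY 𝔸 i) {g : B6.Geometry}

omit [CompleteSpace 𝔸] [FiniteDimensional ℝ 𝔸] in
/-- `coordOpK` is linear in the family (scalars). [cite: Balaban1985BackgroundPropagators, (3.42) p.397, dictionary] -/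
private theorem coordOpK_smul' {S D : Type} (r : ℝ) (T : D → (S → 𝔸) →ₗ[ℝ] (S → 𝔸)) :
    coordOpK b (fun ν => r • T ν) = r • coordOpK b T := by
  apply LinearMap.ext; intro f; funext p
  simp only [coordOpK_apply, LinearMap.smul_apply, Pi.smul_apply, map_smul, Finsupp.coe_smul, smul_eq_mul]

omit [FiniteDimensional ℝ 𝔸] in
/-- ★ the `∇_U`-composite of a letter model is the model of the family `η⁻¹·∇_{U,ν}∘O`: `DcoS ∘ coordOpK b (O) = coordOpK b (ν ↦ η⁻¹•(∇_{U,ν} ∘ O))`.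
[cite: Balaban1985BackgroundPropagators, (3.42) p.397 («∇_UG′(U)»), (3.49) p.399 («DP»), dictionary] -/
theorem DcoS_comp_coordOpK (U₁ : B.Cfg) :
    DcoS i b B cfg U₁ ∘ₗ coordOpK b (fun _ : Fin (d + 1) => (O (cfg U₁)).restrictScalars ℝ) =
      coordOpK b (fun ν : Fin (d + 1) => (etaS i)⁻¹ • ((cdSL i (cfg U₁) ν).restrictScalars ℝ ∘ₗ (O (cfg U₁)).restrictScalars ℝ)) := by
  rw [coordOpK_smul', DcoS, LinearMap.smul_comp, coordOpK_comp]

omit [FiniteDimensional ℝ 𝔸] in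
/-- ★ the `∇*_U`-composite of a letter model is the model of the family `η⁻¹·O∘∇*_{U,ν}`: `coordOpK b (O) ∘ DscoS = coordOpK b (ν ↦ η⁻¹•(O ∘ ∇*_{U,ν}))`.
[cite: Balaban1985BackgroundPropagators, (3.42) p.397 («G′(U)∇*_U»), (3.49) p.399 («PD*»), dictionary] -/
theorem coordOpK_comp_DscoS (U₁ : B.Cfg) :
    coordOpK b (fun _ : Fin (d + 1) => (O (cfg U₁)).restrictScalars ℝ) ∘ₗ DscoS i b B cfg U₁ =
      coordOpK b (fun ν : Fin (d + 1) => (etaS i)⁻¹ • ((O (cfg U₁)).restrictScalars ℝ ∘ₗ (cdsSL i (cfg U₁) ν).restrictScalars ℝ)) := by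
  rw [coordOpK_smul', DscoS, LinearMap.comp_smul, coordOpK_comp]

open Classical in
/-- ★★ **THE LETTER MODEL HAS THE BLOCK MAJORANT READ FROM ALL-BLOCKS (3.49)₁ ENTRIES**: on the site carrier with block map `p ↦ σ p.1`,
`coordOpK b (O_U)` has the majorant `K` whenever `coordBound·basisBound·Σ_{w : σ w = y′} η^{d′}·P₀(Δ(z), Δ(w)) ≤ K(σ z, y′)`.
[cite: Balaban1985BackgroundPropagators, (3.49) p.399; Balaban1984PropagatorsII, (2.51) p.232] -/
theorem hasMajorant_model₀ [DecidableEq g.Site] (σ : SiteY i → g.Site) (U₁ : B.Cfg) {K : g.Site → g.Site → ℝ}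
    (hK : ∀ (z : SiteY i) (y' : g.Site), coordBound39 b * basisBound39 b *
      (∑ w ∈ Finset.univ.filter (fun w => σ w = y'), etaS i ^ (d + 1) * fineEntryS i O (cfg U₁) (blkOf i.D.toDomains z) (blkOf i.D.toDomains w) 0) ≤
        K (σ z) y') :
    HasMajorant (g := g) (fun p : XSK κ i => σ p.1) (coordOpK b (fun _ : Fin (d + 1) => (O (cfg U₁)).restrictScalars ℝ)) K :=
  hasMajorant_coordOpK_of_kernel b σ _ (fun z w => etaS i ^ (d + 1) * fineEntryS i O (cfg U₁) (blkOf i.D.toDomains z) (blkOf i.D.toDomains w) 0)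
    (fun _ z w a => norm_apply_deltaY_le_fineEntryS₀ i O (cfg U₁) z w a)
    (fun _ _ => mul_nonneg (pow_nonneg (etaS_pos i).le _) (B9Ineq349SiteReading.fineEntryS_nonneg i O _ _ _ 0)) hK

open Classical in
/-- ★★ **THE `∇_U`-COMPOSITE OF THE LETTER MODEL HAS THE BLOCK MAJORANT READ FROM ALL-BLOCKS (3.49)₂ ENTRIES**: `DcoS ∘ coordOpK b (O_U)` has the
majorant `K` whenever `coordBound·basisBound·Σ_{w : σ w = y′} η^{d′}·P₁(Δ(z), Δ(w)) ≤ K(σ z, y′)`.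
[cite: Balaban1985BackgroundPropagators, (3.49) p.399, (3.3) p.390; Balaban1984PropagatorsII, (2.51) p.232] -/
theorem hasMajorant_model₁ [DecidableEq g.Site] (σ : SiteY i → g.Site) (U₁ : B.Cfg) {K : g.Site → g.Site → ℝ}
    (hK : ∀ (z : SiteY i) (y' : g.Site), coordBound39 b * basisBound39 b *
      (∑ w ∈ Finset.univ.filter (fun w => σ w = y'), etaS i ^ (d + 1) * fineEntryS i O (cfg U₁) (blkOf i.D.toDomains z) (blkOf i.D.toDomains w) 1) ≤
        K (σ z) y') :
    HasMajorant (g := g) (fun p : XSK κ i => σ p.1)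
      (DcoS i b B cfg U₁ ∘ₗ coordOpK b (fun _ : Fin (d + 1) => (O (cfg U₁)).restrictScalars ℝ)) K := by
  rw [DcoS_comp_coordOpK]
  refine hasMajorant_coordOpK_of_kernel b σ _
    (fun z w => etaS i ^ (d + 1) * fineEntryS i O (cfg U₁) (blkOf i.D.toDomains z) (blkOf i.D.toDomains w) 1) (fun ν z w a => ?_)
    (fun _ _ => mul_nonneg (pow_nonneg (etaS_pos i).le _) (B9Ineq349SiteReading.fineEntryS_nonneg i O _ _ _ 1)) hK
  have hη := etaS_pos i
  rw [LinearMap.smul_apply, Pi.smul_apply, norm_smul, Real.norm_eq_abs, abs_of_pos (inv_pos.2 hη)]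
  show (etaS i)⁻¹ * ‖cdS i (cfg U₁) ν (O (cfg U₁) (deltaY w a)) z‖ ≤ _
  have h := norm_cdS_apply_deltaY_le_fineEntryS₁ i O (cfg U₁) ν z w a
  calc (etaS i)⁻¹ * ‖cdS i (cfg U₁) ν (O (cfg U₁) (deltaY w a)) z‖
      ≤ (etaS i)⁻¹ * (etaS i ^ (d + 1 + 1) * fineEntryS i O (cfg U₁) (blkOf i.D.toDomains z) (blkOf i.D.toDomains w) 1 * ‖a‖) :=
        mul_le_mul_of_nonneg_left h (inv_nonneg.2 hη.le)
    _ = etaS i ^ (d + 1) * fineEntryS i O (cfg U₁) (blkOf i.D.toDomains z) (blkOf i.D.toDomains w) 1 * ‖a‖ := by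
        rw [pow_succ]; field_simp

open Classical in
/-- ★★ **THE `∇*_U`-COMPOSITE OF THE LETTER MODEL HAS THE BLOCK MAJORANT READ FROM ALL-BLOCKS (3.49)₃ ENTRIES**: `coordOpK b (O_U) ∘ DscoS` has the
majorant `K` whenever `coordBound·basisBound·Σ_{w : σ w = y′} η^{d′}·P₂(Δ(z), Δ(w)) ≤ K(σ z, y′)`.
[cite: Balaban1985BackgroundPropagators, (3.49) p.399, (3.8) p.392; Balaban1984PropagatorsII, (2.51) p.232] -/
theorem hasMajorant_model₂ [DecidableEq g.Site] (σ : SiteY i → g.Site) (U₁ : B.Cfg) {K : g.Site → g.Site → ℝ}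
    (hK : ∀ (z : SiteY i) (y' : g.Site), coordBound39 b * basisBound39 b *
      (∑ w ∈ Finset.univ.filter (fun w => σ w = y'), etaS i ^ (d + 1) * fineEntryS i O (cfg U₁) (blkOf i.D.toDomains z) (blkOf i.D.toDomains w) 2) ≤
        K (σ z) y') :
    HasMajorant (g := g) (fun p : XSK κ i => σ p.1)
      (coordOpK b (fun _ : Fin (d + 1) => (O (cfg U₁)).restrictScalars ℝ) ∘ₗ DscoS i b B cfg U₁) K := by
  rw [coordOpK_comp_DscoS]
  refine hasMajorant_coordOpK_of_kernel b σ _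
    (fun z w => etaS i ^ (d + 1) * fineEntryS i O (cfg U₁) (blkOf i.D.toDomains z) (blkOf i.D.toDomains w) 2) (fun ν z w a => ?_)
    (fun _ _ => mul_nonneg (pow_nonneg (etaS_pos i).le _) (B9Ineq349SiteReading.fineEntryS_nonneg i O _ _ _ 2)) hK
  have hη := etaS_pos i
  rw [LinearMap.smul_apply, Pi.smul_apply, norm_smul, Real.norm_eq_abs, abs_of_pos (inv_pos.2 hη)]
  show (etaS i)⁻¹ * ‖O (cfg U₁) (cdsS i (cfg U₁) ν (deltaY w a)) z‖ ≤ _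
  have h := norm_apply_cdsS_deltaY_le_fineEntryS₂ i O (cfg U₁) ν z w a
  calc (etaS i)⁻¹ * ‖O (cfg U₁) (cdsS i (cfg U₁) ν (deltaY w a)) z‖
      ≤ (etaS i)⁻¹ * (etaS i ^ (d + 1 + 1) * fineEntryS i O (cfg U₁) (blkOf i.D.toDomains z) (blkOf i.D.toDomains w) 2 * ‖a‖) :=
        mul_le_mul_of_nonneg_left h (inv_nonneg.2 hη.le)
    _ = etaS i ^ (d + 1) * fineEntryS i O (cfg U₁) (blkOf i.D.toDomains z) (blkOf i.D.toDomains w) 2 * ‖a‖ := by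
        rw [pow_succ]; field_simp

end Models

end Literature.MathematicalPhysics.QuantumFieldTheory.Balaban1983to89.B9SiteKernelBlockMajorant

end
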